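import Summits.QuantumFields.YangMills.Theorems.PencilRigidityNPointIsotropyRiemannSum
import Literature.MathematicalPhysics.QuantumLattice.MeshUniformLatticeSums
import Literature.MathematicalPhysics.AQFT.OffDiagonalFlatDecay
import HarnessLib

/-!
# Dominated tie limit, I: weighted Riemann sums over exploding product boxes in `(ℝ⁴)ⁿ`

Helper file for Stub 1b `stub_dominatedTieLimit` of line `boosts-inherit-mirrors` of crux
`MirrorModularBoosts.CurvatureBoostCovariance` (stmt-QuantumFields-9663), reshape 8 of the registered
skeleton `Cruxes/CurvatureBoostCovariance/Lines/boosts_inherit_mirrors.lean`; it proves the registered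
helper stub `stub_weightedRiemannSums` (statement below).  Elementary real analysis over Mathlib and
the tree's lattice vocabulary (`box 4 L = {-L, …, L}⁴ ⊆ ℤ⁴`, `siteToE : ℤ⁴ → ℝ⁴`, the coincidence
locus `{x | ∃ i ≠ j, xᵢ = xⱼ}`); no definitions are introduced — the product cell
`{z | ∀ i μ, z_{iμ} ∈ [a x_{iμ}, a x_{iμ} + a)}` of a multi-site `x : Fin n → ℤ⁴` and the floor
multi-site `(⌊z_{iμ}/a⌋)_{iμ}` are written out as Mathlib terms, exactly as in the one-point file
`PencilRigidityNPointIsotropyRiemannSum`, whose cells, floors and volumes are reused factorwise.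

Statement (`stub_weightedRiemannSums`).  Let `n > 0` and let `g ≥ 0` be measurable on `(ℝ⁴)ⁿ`,
continuous off the coincidence locus, with `g y ≤ K (1 + ‖y‖)^{-8n}`.  Then (i) `g ∈ L¹`;
(ii) `(a⁴)ⁿ Σ_{x ∈ (box 4 L)ⁿ} g(a x) ≤ K 4^{4n}` for every mesh `0 < a ≤ 1` and every box;
(iii) for spacings `a_k → 0⁺` and half-sides with `a_k L_k → ∞`,
`(a_k⁴)ⁿ Σ_{x ∈ (box 4 L_k)ⁿ} g(a_k x) → ∫ g`.

Proof.  (i) `8n > 4n = dim (ℝ⁴)ⁿ`, so the majorant is integrable (`integrable_one_add_norm`).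
(ii) Termwise comparison with the Japanese bracket of order `8n`, whose lattice Riemann sums are
bounded uniformly in the mesh and the box (`sum_piFinset_box_japaneseBracket_le`, `(2(a+1))^{4n} ≤ 4^{4n}`).
(iii) Dominated convergence (namespace `…BoostsInheritMirrors.DominatedTieLimit`): the Riemann sum is
the integral of the product-box step function `Σ_{x ∈ boxⁿ} g(a x) 1_{cell(a,x)}` (cells have volume
`(a⁴)ⁿ` for the product Lebesgue measure on `Fin n → EuclideanSpace ℝ (Fin 4)`, `integral_piStep`); a
point `z` lies exactly in the cell of its floor multi-site, `a_k ⌊z/a_k⌋ → z` and eventually lies in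
the box, so the step functions converge to `g(z)` at every continuity point of `g` (`piStep_apply`),
i.e. almost everywhere, because the coincidence locus is Lebesgue-null (`volume_coincidenceLocus`: a
finite union of the proper linear subspaces `{x_i = x_j}`, `Measure.addHaar_submodule`); and for
`a_k ≤ 1` the step functions are dominated by `K 5^{8n} (1 + ‖z‖)^{-8n}` (`norm_piStep_le`, from
`‖z - a ⌊z/a⌋‖ ≤ 4a`), which is integrable.  The general statement is `tendsto_riemannSum_piBox`
(any exponent `p > 4n`, `g` continuous a.e.).

References: folklore (J. Glimm, A. Jaffe, Quantum Physics (1987) §9.5–9.6, lattice approximation and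
Riemann sums; K. Osterwalder, R. Schrader, Comm. Math. Phys. 42 (1975) §2, counting estimates for
lattice approximants on `⁰𝒮`). [folklore]
-/

noncomputable section

namespace Summit.QuantumFields.YangMills.Theorems.CurvatureBoostCovariance.BoostsInheritMirrors

open scoped BigOperators SchwartzMap
open MeasureTheory Filter Topology
open Literature.MathematicalPhysics.QuantumLattice Literature.MathematicalPhysics.AQFT
open Literature.Probability.LatticeModels (box mem_box Site)
open Summit.QuantumFields.YangMills.Theorems.NPointIsotropy.ComplexRotationBandlimit

namespace DominatedTieLimit

/-! ## Product cells of multi-sites and the product-box step function -/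

section Cells

variable {n : ℕ}

/-- A multi-point lies in the product cell of the multi-site `x` iff its coordinatewise floor
multi-site is `x` (mesh `a > 0`). [folklore] -/
theorem mem_piCell_iff {a : ℝ} (ha : 0 < a) {x : Fin n → Site 4} {z : Fin n → EuclideanSpace ℝ (Fin 4)} :
    z ∈ {v : Fin n → EuclideanSpace ℝ (Fin 4) | ∀ i μ, v i μ ∈ Set.Ico (a * (x i μ : ℝ)) (a * (x i μ : ℝ) + a)} ↔
      (fun i μ => ⌊z i μ / a⌋) = x := by
  rw [Set.mem_setOf_eq, funext_iff]
  exact forall_congr' fun i => mem_cell_iff ha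

/-- Every multi-point lies in the product cell of its floor multi-site. [folklore] -/
theorem mem_piCell_floor {a : ℝ} (ha : 0 < a) (z : Fin n → EuclideanSpace ℝ (Fin 4)) :
    z ∈ {v : Fin n → EuclideanSpace ℝ (Fin 4) | ∀ i μ, v i μ ∈
      Set.Ico (a * ((⌊z i μ / a⌋ : ℤ) : ℝ)) (a * ((⌊z i μ / a⌋ : ℤ) : ℝ) + a)} :=
  (mem_piCell_iff ha (x := fun i μ => ⌊z i μ / a⌋)).2 rfl

/-- The product cell is the product over `Fin n` of one-point cells. [folklore] -/
theorem piCell_eq_pi (a : ℝ) (x : Fin n → Site 4) :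
    {v : Fin n → EuclideanSpace ℝ (Fin 4) | ∀ i μ, v i μ ∈ Set.Ico (a * (x i μ : ℝ)) (a * (x i μ : ℝ) + a)} =
      Set.pi Set.univ (fun i => {u : EuclideanSpace ℝ (Fin 4) | ∀ μ, u μ ∈ Set.Ico (a * (x i μ : ℝ)) (a * (x i μ : ℝ) + a)}) := by
  ext z
  simp

/-- Product cells are measurable. [folklore] -/
theorem measurableSet_piCell (a : ℝ) (x : Fin n → Site 4) :
    MeasurableSet {v : Fin n → EuclideanSpace ℝ (Fin 4) | ∀ i μ, v i μ ∈ Set.Ico (a * (x i μ : ℝ)) (a * (x i μ : ℝ) + a)} := by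
  rw [piCell_eq_pi]
  exact MeasurableSet.univ_pi fun i => measurableSet_cell a (x i)

/-- The Lebesgue volume of a product cell of mesh `a ≥ 0` is `(a⁴)ⁿ`. [folklore] -/
theorem volume_piCell {a : ℝ} (ha : 0 ≤ a) (x : Fin n → Site 4) :
    volume {v : Fin n → EuclideanSpace ℝ (Fin 4) | ∀ i μ, v i μ ∈ Set.Ico (a * (x i μ : ℝ)) (a * (x i μ : ℝ) + a)} =
      ENNReal.ofReal ((a ^ 4) ^ n) := by
  rw [piCell_eq_pi, volume_pi_pi]
  simp only [volume_cell ha]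
  rw [Finset.prod_const, Finset.card_univ, Fintype.card_fin, ENNReal.ofReal_pow (pow_nonneg ha 4)]

/-- A constant on a product cell is integrable. [folklore] -/
theorem integrable_piCell_indicator {a : ℝ} (ha : 0 ≤ a) (x : Fin n → Site 4) (c : ℝ) :
    Integrable ({v : Fin n → EuclideanSpace ℝ (Fin 4) | ∀ i μ, v i μ ∈
      Set.Ico (a * (x i μ : ℝ)) (a * (x i μ : ℝ) + a)}.indicator fun _ => c) volume :=
  (integrableOn_const (by rw [volume_piCell ha]; exact ENNReal.ofReal_ne_top)).integrable_indicator
    (measurableSet_piCell a x)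

/-- The product-box step function is integrable. [folklore] -/
theorem integrable_piStep (g : (Fin n → EuclideanSpace ℝ (Fin 4)) → ℝ) {a : ℝ} (ha : 0 ≤ a) (L : ℕ) :
    Integrable (fun z : Fin n → EuclideanSpace ℝ (Fin 4) => ∑ x ∈ Fintype.piFinset (fun _ : Fin n => box 4 L),
      {v : Fin n → EuclideanSpace ℝ (Fin 4) | ∀ i μ, v i μ ∈ Set.Ico (a * (x i μ : ℝ)) (a * (x i μ : ℝ) + a)}.indicator
        (fun _ => g (fun i => a • siteToE (x i))) z) volume :=
  integrable_finsetSum _ fun x _ => integrable_piCell_indicator ha x _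

/-- The integral of the product-box step function is the Riemann sum `(a⁴)ⁿ Σ_{x ∈ boxⁿ} g(a x)`.
[folklore] -/
theorem integral_piStep (g : (Fin n → EuclideanSpace ℝ (Fin 4)) → ℝ) {a : ℝ} (ha : 0 ≤ a) (L : ℕ) :
    ∫ z : Fin n → EuclideanSpace ℝ (Fin 4), ∑ x ∈ Fintype.piFinset (fun _ : Fin n => box 4 L),
      {v : Fin n → EuclideanSpace ℝ (Fin 4) | ∀ i μ, v i μ ∈ Set.Ico (a * (x i μ : ℝ)) (a * (x i μ : ℝ) + a)}.indicator
        (fun _ => g (fun i => a • siteToE (x i))) z =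
      (a ^ 4) ^ n * ∑ x ∈ Fintype.piFinset (fun _ : Fin n => box 4 L), g (fun i => a • siteToE (x i)) := by
  rw [integral_finsetSum _ fun x _ => integrable_piCell_indicator ha x _, Finset.mul_sum]
  refine Finset.sum_congr rfl fun x _ => ?_
  rw [integral_indicator_const _ (measurableSet_piCell a x), measureReal_def, volume_piCell ha,
    ENNReal.toReal_ofReal (by positivity), smul_eq_mul]

/-- Pointwise value of the product-box step function: `g(a ⌊z/a⌋)` if `⌊z/a⌋ ∈ boxⁿ`, else `0`.
[folklore] -/
theorem piStep_apply (g : (Fin n → EuclideanSpace ℝ (Fin 4)) → ℝ) {a : ℝ} (ha : 0 < a) (L : ℕ) (z : Fin n → EuclideanSpace ℝ (Fin 4)) :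
    ∑ x ∈ Fintype.piFinset (fun _ : Fin n => box 4 L),
      {v : Fin n → EuclideanSpace ℝ (Fin 4) | ∀ i μ, v i μ ∈ Set.Ico (a * (x i μ : ℝ)) (a * (x i μ : ℝ) + a)}.indicator
        (fun _ => g (fun i => a • siteToE (x i))) z =
      if (fun i μ => ⌊z i μ / a⌋) ∈ Fintype.piFinset (fun _ : Fin n => box 4 L) then
        g (fun i => a • siteToE (fun μ => ⌊z i μ / a⌋)) else 0 := by
  split_ifs with h
  · rw [Finset.sum_eq_single_of_mem _ h fun x _ hx =>
      Set.indicator_of_notMem (fun hz => hx ((mem_piCell_iff ha).1 hz).symm) _]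
    exact Set.indicator_of_mem (mem_piCell_floor ha z) _
  · refine Finset.sum_eq_zero fun x hx => Set.indicator_of_notMem (fun hz => h ?_) _
    rwa [(mem_piCell_iff ha).1 hz]

/-- As the mesh tends to zero the scaled floor multi-sites of `z` tend to `z`. [folklore] -/
theorem tendsto_smul_floor_pi {a : ℕ → ℝ} (ha : ∀ k, 0 < a k) (ha0 : Tendsto a atTop (𝓝 0))
    (z : Fin n → EuclideanSpace ℝ (Fin 4)) :
    Tendsto (fun k => (fun i => a k • siteToE (fun μ => ⌊z i μ / a k⌋) : Fin n → EuclideanSpace ℝ (Fin 4))) atTop (𝓝 z) :=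
  tendsto_pi_nhds.2 fun i => tendsto_smul_floor ha ha0 (z i)

/-- If `a_k L_k → ∞` the floor multi-site of `z` eventually lies in `(box 4 L_k)ⁿ`. [folklore] -/
theorem eventually_floor_mem_piBox {a : ℕ → ℝ} {L : ℕ → ℕ} (ha : ∀ k, 0 < a k)
    (haL : Tendsto (fun k => a k * L k) atTop atTop) (z : Fin n → EuclideanSpace ℝ (Fin 4)) :
    ∀ᶠ k in atTop, (fun i μ => ⌊z i μ / a k⌋) ∈ Fintype.piFinset (fun _ : Fin n => box 4 (L k)) :=
  (eventually_all.2 fun i => eventually_floor_mem_box ha haL (z i)).mono fun _ hk =>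
    Fintype.mem_piFinset.2 hk

/-- A multi-point is within `4a` (sup norm) of its scaled floor multi-site. [folklore] -/
theorem norm_sub_floor_pi_le {a : ℝ} (ha : 0 < a) (z : Fin n → EuclideanSpace ℝ (Fin 4)) :
    ‖z - fun i => a • siteToE (fun μ => ⌊z i μ / a⌋)‖ ≤ 4 * a := by
  refine (pi_norm_le_iff_of_nonneg (by positivity)).2 fun i => ?_
  simpa using norm_sub_floor_le ha (z i)

/-- **Integrable majorant.** If `‖g y‖ ≤ K (1 + ‖y‖)^{-p}` then for meshes `0 < a ≤ 1` the value of
the product-box step function at `z` is at most `K 5^p (1 + ‖z‖)^{-p}`. [folklore] -/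
theorem norm_piStep_le {g : (Fin n → EuclideanSpace ℝ (Fin 4)) → ℝ} {K : ℝ} {p : ℕ}
    (hK : ∀ y, ‖g y‖ ≤ K * ((1 + ‖y‖) ^ p)⁻¹) {a : ℝ} (ha : 0 < a) (ha1 : a ≤ 1) (L : ℕ)
    (z : Fin n → EuclideanSpace ℝ (Fin 4)) :
    ‖if (fun i μ => ⌊z i μ / a⌋) ∈ Fintype.piFinset (fun _ : Fin n => box 4 L) then
        g (fun i => a • siteToE (fun μ => ⌊z i μ / a⌋)) else 0‖ ≤
      K * 5 ^ p * ((1 + ‖z‖) ^ p)⁻¹ := by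
  have hK0 : 0 ≤ K := by simpa using (norm_nonneg _).trans (hK 0)
  split_ifs with h
  · set y : Fin n → EuclideanSpace ℝ (Fin 4) := fun i => a • siteToE (fun μ => ⌊z i μ / a⌋)
    have hzy : ‖z - y‖ ≤ 4 := (norm_sub_floor_pi_le ha z).trans (by linarith)
    have h1 : 1 + ‖z‖ ≤ 5 * (1 + ‖y‖) := by
      have h' := norm_le_norm_add_norm_sub' z y
      linarith [norm_nonneg y]
    have h2 : (1 + ‖z‖) ^ p ≤ 5 ^ p * (1 + ‖y‖) ^ p := by
      rw [← mul_pow]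
      exact pow_le_pow_left₀ (by positivity) h1 _
    have hy : 0 < (1 + ‖y‖) ^ p := by positivity
    have hz : 0 < (1 + ‖z‖) ^ p := by positivity
    have h3 : ((1 + ‖y‖) ^ p)⁻¹ ≤ 5 ^ p * ((1 + ‖z‖) ^ p)⁻¹ := by
      rw [← div_eq_mul_inv, le_div_iff₀ hz, inv_mul_le_iff₀ hy]
      exact h2.trans_eq (mul_comm _ _)
    calc ‖g y‖ ≤ K * ((1 + ‖y‖) ^ p)⁻¹ := hK y
      _ ≤ K * (5 ^ p * ((1 + ‖z‖) ^ p)⁻¹) := mul_le_mul_of_nonneg_left h3 hK0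
      _ = K * 5 ^ p * ((1 + ‖z‖) ^ p)⁻¹ := by ring
  · rw [norm_zero]
    positivity

/-- `dim (ℝ⁴)ⁿ = 4n`. [folklore] -/
theorem finrank_pi_euclideanSpace_four (n : ℕ) : Module.finrank ℝ (Fin n → EuclideanSpace ℝ (Fin 4)) = 4 * n := by
  rw [Module.finrank_pi_fintype]
  simp [mul_comm]

/-- The majorant `M (1 + ‖z‖)^{-p}` is Lebesgue integrable on `(ℝ⁴)ⁿ` for `p > 4n`. [folklore] -/
theorem integrable_piMajorant {p : ℕ} (hp : 4 * n < p) (M : ℝ) :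
    Integrable (fun z : Fin n → EuclideanSpace ℝ (Fin 4) => M * ((1 + ‖z‖) ^ p)⁻¹) volume := by
  have hr : (Module.finrank ℝ (Fin n → EuclideanSpace ℝ (Fin 4)) : ℝ) < ((p : ℕ) : ℝ) := by
    rw [finrank_pi_euclideanSpace_four]
    exact_mod_cast hp
  refine ((integrable_one_add_norm hr).const_mul M).congr (ae_of_all _ fun x => ?_)
  simp only
  rw [Real.rpow_neg (by positivity), Real.rpow_natCast]

/-- **Riemann sums over exploding fine product boxes.** For `g : (ℝ⁴)ⁿ → ℝ` continuous almost
everywhere with `‖g y‖ ≤ K (1 + ‖y‖)^{-p}`, `p > 4n`, spacings `a_k > 0`, `a_k → 0`, and half-sides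
`L_k` with `a_k L_k → ∞`: `(a_k⁴)ⁿ Σ_{x ∈ (box 4 L_k)ⁿ} g(a_k x) → ∫ g` (dominated convergence for the
product-box step functions). [folklore] -/
theorem tendsto_riemannSum_piBox {p : ℕ} (hp : 4 * n < p) (g : (Fin n → EuclideanSpace ℝ (Fin 4)) → ℝ) {K : ℝ}
    (hK : ∀ y, ‖g y‖ ≤ K * ((1 + ‖y‖) ^ p)⁻¹)
    (hgc : ∀ᵐ z ∂(volume : Measure (Fin n → EuclideanSpace ℝ (Fin 4))), ContinuousAt g z)
    (a : ℕ → ℝ) (L : ℕ → ℕ) (ha : ∀ k, 0 < a k) (ha0 : Tendsto a atTop (𝓝 0))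
    (haL : Tendsto (fun k => a k * L k) atTop atTop) :
    Tendsto (fun k => (a k ^ 4) ^ n *
      ∑ x ∈ Fintype.piFinset (fun _ : Fin n => box 4 (L k)), g (fun i => a k • siteToE (x i)))
      atTop (𝓝 (∫ z, g z)) := by
  have hfun : (fun k => (a k ^ 4) ^ n *
      ∑ x ∈ Fintype.piFinset (fun _ : Fin n => box 4 (L k)), g (fun i => a k • siteToE (x i))) =
      fun k => ∫ z : Fin n → EuclideanSpace ℝ (Fin 4), ∑ x ∈ Fintype.piFinset (fun _ : Fin n => box 4 (L k)),
        {v : Fin n → EuclideanSpace ℝ (Fin 4) | ∀ i μ, v i μ ∈ Set.Ico (a k * (x i μ : ℝ)) (a k * (x i μ : ℝ) + a k)}.indicator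
          (fun _ => g (fun i => a k • siteToE (x i))) z :=
    funext fun k => (integral_piStep g (ha k).le (L k)).symm
  rw [hfun]
  refine tendsto_integral_filter_of_dominated_convergence
    (fun z => K * 5 ^ p * ((1 + ‖z‖) ^ p)⁻¹) ?_ ?_ (integrable_piMajorant hp _) ?_
  · exact Eventually.of_forall fun k => (integrable_piStep g (ha k).le (L k)).aestronglyMeasurable
  · filter_upwards [ha0.eventually (eventually_le_nhds zero_lt_one)] with k hk
    refine ae_of_all _ fun z => ?_
    rw [piStep_apply g (ha k)]
    exact norm_piStep_le hK (ha k) hk (L k) z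
  · filter_upwards [hgc] with z hz
    have h1 : Tendsto (fun k => g (fun i => a k • siteToE (fun μ => ⌊z i μ / a k⌋))) atTop
        (𝓝 (g z)) :=
      hz.tendsto.comp (tendsto_smul_floor_pi ha ha0 z)
    refine h1.congr' ?_
    filter_upwards [eventually_floor_mem_piBox ha haL z] with k hk
    rw [piStep_apply g (ha k), if_pos hk]

/-- **The coincidence locus of `(ℝ⁴)ⁿ` is Lebesgue-null** (a finite union of proper linear subspaces
`{x_i = x_j}`). [folklore] -/
theorem volume_coincidenceLocus (n : ℕ) : volume (coincidenceLocus n (EuclideanSpace ℝ (Fin 4))) = 0 := by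
  have h : coincidenceLocus n (EuclideanSpace ℝ (Fin 4)) = ⋃ i : Fin n, ⋃ j : Fin n, ⋃ (_ : i ≠ j), {x | x i = x j} := by
    ext x
    simp [coincidenceLocus]
  rw [h]
  refine measure_iUnion_null fun i => measure_iUnion_null fun j => measure_iUnion_null fun hij => ?_
  have hker : {x : Fin n → EuclideanSpace ℝ (Fin 4) | x i = x j} =
      (LinearMap.ker ((LinearMap.proj i : (Fin n → EuclideanSpace ℝ (Fin 4)) →ₗ[ℝ] EuclideanSpace ℝ (Fin 4)) - LinearMap.proj j) :
        Set (Fin n → EuclideanSpace ℝ (Fin 4))) := by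
    ext x
    simp [sub_eq_zero]
  have hne : LinearMap.ker ((LinearMap.proj i : (Fin n → EuclideanSpace ℝ (Fin 4)) →ₗ[ℝ] EuclideanSpace ℝ (Fin 4)) - LinearMap.proj j) ≠ ⊤ := by
    intro htop
    have hx : (Pi.single i (EuclideanSpace.single (0 : Fin 4) (1 : ℝ)) : Fin n → EuclideanSpace ℝ (Fin 4)) ∈
        LinearMap.ker ((LinearMap.proj i : (Fin n → EuclideanSpace ℝ (Fin 4)) →ₗ[ℝ] EuclideanSpace ℝ (Fin 4)) - LinearMap.proj j) := by
      rw [htop]; trivial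
    rw [LinearMap.mem_ker, LinearMap.sub_apply, LinearMap.proj_apply, LinearMap.proj_apply,
      Pi.single_eq_same, Pi.single_eq_of_ne hij.symm, sub_zero] at hx
    have h0 := congrArg (fun v : EuclideanSpace ℝ (Fin 4) => v 0) hx
    simp at h0
  rw [hker]
  exact Measure.addHaar_submodule volume _ hne

end Cells

/-! ## Lattice sums of `⁰𝒮` functions against tempered densities -/

section Lattice

variable {n : ℕ}

/-- **Mesh-uniform bound.** If `h y ≤ K (1 + ‖y‖)^{-8n}` with `K ≥ 0` then for meshes `0 < a ≤ 1` and
all boxes `(a⁴)ⁿ Σ_{x ∈ boxⁿ} h(a x) ≤ K 4^{4n}`: termwise comparison with the Japanese bracket of order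
`8n = 2 · dim`, whose Riemann sums are bounded uniformly in the mesh and the box
(`sum_piFinset_box_japaneseBracket_le`). [folklore] -/
theorem latticeSum_majorant_le {a : ℝ} (ha : 0 < a) (ha1 : a ≤ 1) (L : ℕ) {K : ℝ} (hK : 0 ≤ K)
    (h : (Fin n → EuclideanSpace ℝ (Fin 4)) → ℝ) (hh : ∀ y, h y ≤ K * ((1 + ‖y‖) ^ (8 * n))⁻¹) :
    (a ^ 4) ^ n * ∑ x ∈ Fintype.piFinset (fun _ : Fin n => box 4 L), h (fun i => a • siteToE (x i)) ≤
      K * 4 ^ (4 * n) := by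
  calc (a ^ 4) ^ n * ∑ x ∈ Fintype.piFinset (fun _ : Fin n => box 4 L), h (fun i => a • siteToE (x i))
      ≤ (a ^ 4) ^ n * ∑ x ∈ Fintype.piFinset (fun _ : Fin n => box 4 L),
          K * ((1 + ‖fun i => a • siteToE (x i)‖) ^ (8 * n))⁻¹ := by
        gcongr with x hx
        exact hh _
    _ = K * ∑ x ∈ Fintype.piFinset (fun _ : Fin n => box 4 L),
          a ^ (4 * n) / (1 + ‖fun i => a • siteToE (x i)‖) ^ (2 * (4 * n)) := by
        rw [← pow_mul, Finset.mul_sum, Finset.mul_sum]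
        exact Finset.sum_congr rfl fun x _ => by ring
    _ ≤ K * (2 * (a + 1)) ^ (4 * n) :=
        mul_le_mul_of_nonneg_left (sum_piFinset_box_japaneseBracket_le a ha.le 4 n L) hK
    _ ≤ K * 4 ^ (4 * n) := by
        gcongr
        linarith

end Lattice


end DominatedTieLimit

/-! ## The registered helper stub -/

/-- **Weighted Riemann sums over exploding product boxes (registered helper stub
`stub_weightedRiemannSums` of crux stmt-QuantumFields-9663, line `boosts-inherit-mirrors`, serving
Stub 1b `stub_dominatedTieLimit`).**  Let `g ≥ 0` be measurable on `(ℝ⁴)ⁿ` (`n > 0`), continuous off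
the coincidence locus, with the tempered majorant `g y ≤ K (1 + ‖y‖)^{-8n}`.  Then (i) `g` is Lebesgue
integrable (`8n > 4n = dim`); (ii) its Riemann sums are bounded uniformly in the mesh `a ≤ 1` and the
box, `(a⁴)ⁿ Σ_{x ∈ (box 4 L)ⁿ} g(a x) ≤ K 4^{4n}`; (iii) along spacings `a_k → 0⁺` and half-sides with
`a_k L_k → ∞` the Riemann sums over the exploding boxes converge, `(a_k⁴)ⁿ Σ_{x ∈ (box 4 L_k)ⁿ} g(a_k x) → ∫ g`
(the locus is Lebesgue-null, so `g` is continuous almost everywhere, and `tendsto_riemannSum_piBox`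
applies). [folklore] -/
theorem stub_weightedRiemannSums : ∀ (n : ℕ), 0 < n → ∀ (g : (Fin n → EuclideanSpace ℝ (Fin 4)) → ℝ) (K : ℝ), Measurable g → ContinuousOn g (Literature.MathematicalPhysics.AQFT.coincidenceLocus n (EuclideanSpace ℝ (Fin 4)))ᶜ → (∀ y, 0 ≤ g y) → (∀ y, g y ≤ K * ((1 + ‖y‖) ^ (8 * n))⁻¹) → MeasureTheory.Integrable g ∧ (∀ (a : ℝ) (L : ℕ), 0 < a → a ≤ 1 → (a ^ 4) ^ n * ∑ x ∈ Fintype.piFinset (fun _ : Fin n => Literature.Probability.LatticeModels.box 4 L), g (fun i => a • Literature.MathematicalPhysics.QuantumLattice.siteToE (x i)) ≤ K * 4 ^ (4 * n)) ∧ ∀ (a : ℕ → ℝ) (L : ℕ → ℕ), (∀ k, 0 < a k) → Filter.Tendsto a Filter.atTop (nhds 0) → Filter.Tendsto (fun k => a k * L k) Filter.atTop Filter.atTop → Filter.Tendsto (fun k => (a k ^ 4) ^ n * ∑ x ∈ Fintype.piFinset (fun _ : Fin n => Literature.Probability.LatticeModels.box 4 (L k)), g (fun i => a k • Literature.MathematicalPhysics.QuantumLattice.siteToE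 (x i))) Filter.atTop (nhds (∫ y, g y)) := by
  intro n hn g K hgm hgc hg0 hgK
  have hMn : 4 * n < 8 * n := by omega
  have hK0 : 0 ≤ K := by simpa using (hg0 0).trans (hgK 0)
  have hgK' : ∀ y, ‖g y‖ ≤ K * ((1 + ‖y‖) ^ (8 * n))⁻¹ := fun y => by
    rw [Real.norm_of_nonneg (hg0 y)]
    exact hgK y
  refine ⟨Integrable.mono' (DominatedTieLimit.integrable_piMajorant hMn K) hgm.aestronglyMeasurable
      (ae_of_all _ hgK'),
    fun a L ha ha1 => DominatedTieLimit.latticeSum_majorant_le ha ha1 L hK0 g hgK,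
    fun a L ha ha0 haL => DominatedTieLimit.tendsto_riemannSum_piBox hMn g hgK' ?_ a L ha ha0 haL⟩
  have hae : ∀ᵐ z ∂(volume : Measure (Fin n → EuclideanSpace ℝ (Fin 4))),
      z ∉ coincidenceLocus n (EuclideanSpace ℝ (Fin 4)) :=
    measure_eq_zero_iff_ae_notMem.1 (DominatedTieLimit.volume_coincidenceLocus n)
  filter_upwards [hae] with z hz
  exact hgc.continuousAt ((isClosed_coincidenceLocus n _).isOpen_compl.mem_nhds hz)

end Summit.QuantumFields.YangMills.Theorems.CurvatureBoostCovariance.BoostsInheritMirrors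

end
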